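import Literature.Computability.QuantumComplexity.KeyedOracleFamily
import Literature.Computability.QuantumComplexity.UniformSubstitution
import Literature.Computability.QuantumComplexity.UnaryCircuitDescription
import Literature.Computability.Complexity.CodeFPArith
import HarnessLib

/-!
# The keyed-oracle family is polynomial-time UNIFORM

Topic `Literature/Computability/QuantumComplexity`; sequel of `KeyedOracleFamily.lean` (`KeyedRun.family`: Hadamards
on `κOf L` key wires, then `F.circ (nOf L)` with every oracle gate enlarged by the prefix wires — parameter wires
`n … L−1` and key wires; its event probabilities are key-averages, `KeyedRun.kernelProb_family_eq_avg_probEvent`). For a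
uniform oracle algorithm `F` and size functions `nOf, κOf` computed in polynomial time on unary numerals the keyed family
is polynomial-time uniform: its description is printed from `1^L` by computing `F`'s own description of `F.circ (nOf L)`
(Arora–Barak 2009, §6.2 Remark 6.7: uniformity = the description function is in `FP`) and relabelling it gate by gate
— a transported gate symbol keeps its numeral and moves its wires along `emb` (`i ↦ i` for `i < n`, `i ↦ L + (i − n)`
otherwise), an oracle query on `k` wires becomes the query on `(L − n) + κ + k` wires whose wire list is the prefix list
followed by the moved wires (Bennett–Bernstein–Brassard–Vazirani 1997, Thm. 4.14: the machine with the subroutine calls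
inserted is obtained by a polynomial-time transformation of descriptions). The transducer is assembled in the typed
`FP` algebra `CodeFP` (`Complexity/CodeFP.lean`) at the level of raw descriptions (`RawDesc`,
`UniformSubstitution.lean`), ORACLE GATES INCLUDED (the abstract-gate route `AbstractGateUniform.lean` is oracle-free).

* `KeyedRun.embW`, `preList`, `retargetRaw`, `hadRaw`, **`rawDescK`** — the raw description of the keyed family as an
  explicit function of `(n, L, m_F, κ)` and the raw gates of `F.circ n`; `ofFn_prefEmb_val`, `toRaw_retargetGate`,
  **`rawDesc_family`** (it IS the raw description of `KeyedRun.family`);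
* `codeFP_embW`, `codeFP_shiftRange`, `codeFP_preList`, `codeFP_retargetRaw`, `codeFP_hadRaw`, **`codeFP_rawDescK`**
  — computed on codes;
* **`KeyedRun.family_isUniform`** — the keyed-oracle family of a uniform `F` with `CodeFP unE unE nOf`,
  `CodeFP unE unE κOf` is uniform.

Everything here is PROVED; the definitions are explicit list functions.

## References

* C. H. Bennett, E. Bernstein, G. Brassard, U. Vazirani, *Strengths and weaknesses of quantum computing*, SIAM J.
  Comput. 26 (1997) 1510–1523, Thm. 4.14 (inserting subroutine calls into a polynomial-time machine)
  [BennettBernsteinBrassardVazirani1997].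
* S. Arora, B. Barak, *Computational Complexity: A Modern Approach*, CUP 2009, §1.3 (closure of polynomial time),
  §6.1–6.2 and Remark 6.7 (descriptions; `P`-uniform families) [AroraBarak2009].
* M. A. Nielsen, I. L. Chuang, *Quantum Computation and Quantum Information*, CUP 2010, §4.3 (wires of a placed gate)
  [NielsenChuang2010].
-/

noncomputable section


namespace Literature.Computability.QuantumComplexity

open _root_.Computability Complexity Complexity.Brick Cryptography
open CodeFP

namespace KeyedRun

/-! ### The raw description of the keyed family -/

/-- **The wire relabelling of the transported circuit** on wire INDICES: `i ↦ i` for `i < n`, else `L + (i − n)`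
(the value of `KeyedRun.emb`). [cite: AroraBarak2009, §6.1 (descriptions of circuits: wire indices)] -/
def embW (n L : ℕ) (i : ℕ) : ℕ := if i < n then i else L + (i - n)

/-- **The list of the prefix wires**: `[n, …, L−1]` (parameter wires) then `[L+m, …, L+m+κ−1]` (key wires), the
values of `KeyedRun.pre`. [cite: AroraBarak2009, §6.1] -/
def preList (n L m κ : ℕ) : List ℕ := (List.range (L - n)).map (fun a => n + a) ++ (List.range κ).map (fun j => L + m + j)

/-- **Raw re-targeting of one raw gate**: a gate symbol keeps its numeral and moves its wires along `embW`; an oracle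
query on `k` wires becomes the query on `(L − n) + κ + k` wires, prefix wires first.
[cite: BennettBernsteinBrassardVazirani1997, Thm. 4.14 (inserting the subroutine calls in the description)] -/
def retargetRaw (n L m κ : ℕ) (γ : RawGate) : RawGate :=
  if γ.1 then (true, ((L - n) + κ) + γ.2.1, preList n L m κ ++ γ.2.2.map (embW n L))
  else (false, γ.2.1, γ.2.2.map (embW n L))

/-- **The raw Hadamard layer** on the key wires `L + m + j`, `j < κ` (the symbol `H` has code `0`).
[cite: AroraBarak2009, §6.1] -/
def hadRaw (L m κ : ℕ) : List RawGate := (List.range κ).map fun j => (false, 0, [L + m + j])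

variable (P : KeyedRun)

/-- **The raw description of the keyed family on instances of length `L`.** [cite: AroraBarak2009, §6.1–6.2] -/
def rawDescK (L : ℕ) : RawDesc :=
  (L, P.mF L + P.κOf L,
    hadRaw L (P.mF L) (P.κOf L) ++ ((P.F.rawDesc (P.nOf L)).2.2).map (retargetRaw (P.nOf L) L (P.mF L) (P.κOf L)))

/-- The raw gate of a Hadamard. [cite: AroraBarak2009, §6.1] -/
theorem toRaw_hOn' {N : ℕ} (i : Fin N) : (hOn i).toRaw = (false, 0, [(i : ℕ)]) := rfl

/-- The prefix wire list is the list of values of `pre`. [cite: AroraBarak2009, §6.1] -/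
theorem ofFn_pre_val (L : ℕ) :
    (List.ofFn fun a : Fin ((L - P.nOf L) + P.κOf L) => ((P.pre L a : Fin (L + P.anc L)) : ℕ)) =
      preList (P.nOf L) L (P.mF L) (P.κOf L) := by
  rw [List.ofFn_add, preList]
  congr 1
  · apply List.ext_getElem
    · simp
    · intro i h1 h2
      simp only [List.getElem_ofFn, List.getElem_map, List.getElem_range]
      rw [pre_val]
      simp only [List.length_ofFn] at h1
      simp [h1]
  · apply List.ext_getElem
    · simp
    · intro i h1 h2
      simp only [List.getElem_ofFn, List.getElem_map, List.getElem_range]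
      rw [pre_val]
      simp

/-- The wire list of an enlarged oracle gate: the prefix wires, then the original wires.
[cite: NielsenChuang2010, §4.3 (wires of a placed gate)] -/
theorem ofFn_prefEmb_val {N Q k : ℕ} (p : Fin Q ↪ Fin N) (e : Fin (k + 1) ↪ Fin N) (h : ∀ a b, p a ≠ e b) :
    (List.ofFn fun i : Fin (Q + (k + 1)) => ((prefEmb p e h i : Fin N) : ℕ)) =
      (List.ofFn fun a => ((p a : Fin N) : ℕ)) ++ List.ofFn fun b => ((e b : Fin N) : ℕ) := by
  rw [List.ofFn_add]
  congr 1
  · refine List.ofFn_inj.2 (funext fun a => ?_)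
    have : Fin.castLE (Nat.le_add_right _ _) a = Fin.castAdd (k + 1) a := Fin.ext rfl
    rw [this, prefEmb_castAdd]
  · refine List.ofFn_inj.2 (funext fun b => ?_)
    rw [prefEmb_natAdd]

/-- **The raw gate of a re-targeted gate is the raw re-targeting of its raw gate.**
[cite: BennettBernsteinBrassardVazirani1997, Thm. 4.14] -/
theorem toRaw_retargetGate (L : ℕ) (γ : QGate cliffordT (P.nOf L + P.mF L)) :
    (retargetGate (P.pre L) (P.emb L) (P.pre_ne_emb L) γ).toRaw =
      retargetRaw (P.nOf L) L (P.mF L) (P.κOf L) γ.toRaw := by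
  cases γ with
  | gate g e =>
    simp only [retargetGate, QGate.toRaw, retargetRaw, List.map_ofFn]
    simp only [Bool.false_eq_true, ↓reduceIte, Prod.mk.injEq, true_and]
    refine List.ofFn_inj.2 (funext fun i => ?_)
    simp only [Function.comp_apply, Function.Embedding.trans_apply, emb_val, embW]
  | oracle k e =>
    simp only [retargetGate, QGate.toRaw, retargetRaw, ↓reduceIte, Prod.mk.injEq, true_and]
    rw [← ofFn_pre_val, List.map_ofFn]
    refine (ofFn_prefEmb_val (P.pre L) (e.trans (P.emb L)) fun a b => P.pre_ne_emb L a (e b)).trans ?_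
    congr 1

/-- **`rawDescK` is the raw description of the keyed family.** [cite: AroraBarak2009, §6.1–6.2] -/
theorem rawDesc_family (L : ℕ) : P.family.rawDesc L = P.rawDescK L := by
  simp only [QCircuitFamily.rawDesc, rawDescK]
  refine congrArg _ (congrArg _ ?_)
  change ((List.ofFn ((P.keyT L).trans (P.pre L))).map hOn ++
    retarget (P.pre L) (P.emb L) (P.pre_ne_emb L) (P.F.circ (P.nOf L)).gates).map QGate.toRaw = _
  rw [List.map_append]
  congr 1
  · rw [hadRaw, List.map_map, List.map_ofFn]
    apply List.ext_getElem
    · simp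
    · intro i h1 h2
      rw [List.getElem_ofFn, List.getElem_map, List.getElem_range]
      simp only [Function.comp_apply, toRaw_hOn', keyT_trans_pre_val]
  · rw [retarget, List.map_map, QCircuit.rawGates, List.map_map]
    refine List.map_congr_left fun γ _ => ?_
    simp only [Function.comp_apply, toRaw_retargetGate]

/-! ### The raw description is computed on codes -/

/-- The code of the context `(n, L, m, κ)`. [cite: AroraBarak2009, §1.3] -/
abbrev ctxE : ℕ × ℕ × ℕ × ℕ → List Bool := pairE natE (pairE natE (pairE natE natE))

/-- `embW` is computed on codes (context `(n, L, m, κ)`, argument the wire index). [cite: AroraBarak2009, §1.3] -/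
theorem codeFP_embW : CodeFP (pairE ctxE natE) natE (fun p : (ℕ × ℕ × ℕ × ℕ) × ℕ => embW p.1.1 p.1.2.1 p.2) := by
  have hn : CodeFP (pairE ctxE natE) natE (fun p : (ℕ × ℕ × ℕ × ℕ) × ℕ => p.1.1) := (fst _ _).fst'
  have hL : CodeFP (pairE ctxE natE) natE (fun p : (ℕ × ℕ × ℕ × ℕ) × ℕ => p.1.2.1) := (fst _ _).snd'.fst'
  have hi : CodeFP (pairE ctxE natE) natE (fun p : (ℕ × ℕ × ℕ × ℕ) × ℕ => p.2) := snd _ _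
  have hc : CodeFP (pairE ctxE natE) bitE (fun p : (ℕ × ℕ × ℕ × ℕ) × ℕ => decide (p.2 < p.1.1)) :=
    natLt.comp (hi.pair hn)
  have he : CodeFP (pairE ctxE natE) natE (fun p : (ℕ × ℕ × ℕ × ℕ) × ℕ => p.1.2.1 + (p.2 - p.1.1)) :=
    natAdd.comp (hL.pair (natSub.comp (hi.pair hn)))
  exact (hc.ite hi he).congr fun p => by simp [embW]

/-- A shifted range is computed on codes: `(s, c) ↦ [s, …, s + c − 1]` from binary `s` and binary `c ≤` a unary
budget. Here in the form `(ctx, (budget, (s, c))) ↦ (range (min c budget)).map (s + ·)`. [cite: AroraBarak2009, §1.3] -/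
theorem codeFP_shiftRange :
    CodeFP (pairE unE (pairE natE natE)) (rawE natE)
      (fun p : ℕ × (ℕ × ℕ) => (List.range (min p.2.2 p.1)).map fun a => p.2.1 + a) := by
  have hb : CodeFP (pairE unE (pairE natE natE)) unE (fun p : ℕ × (ℕ × ℕ) => p.1) := fst _ _
  have hs : CodeFP (pairE unE (pairE natE natE)) natE (fun p : ℕ × (ℕ × ℕ) => p.2.1) := (snd _ _).fst'
  have hc : CodeFP (pairE unE (pairE natE natE)) natE (fun p : ℕ × (ℕ × ℕ) => p.2.2) := (snd _ _).snd'
  have hmin : CodeFP (pairE unE (pairE natE natE)) unE (fun p : ℕ × (ℕ × ℕ) => min p.2.2 p.1) :=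
    unOfNatMin.comp (hb.pair hc)
  have hr : CodeFP (pairE unE (pairE natE natE)) (rawE natE) (fun p : ℕ × (ℕ × ℕ) => List.range (min p.2.2 p.1)) :=
    urange.comp hmin
  have hadd : CodeFP (pairE natE natE) natE (fun q : ℕ × ℕ => q.1 + q.2) := natAdd
  exact ((map hadd).comp (hs.pair hr)).congr fun p => rfl

/-- `preList` is computed on codes from `(L in unary, (n, L, m, κ))` (the unary `L` is the budget of the two ranges:
`L − n ≤ L` and `κ` is supplied in unary separately — here through `min κ budget` with budget `L + κ`).
[cite: AroraBarak2009, §1.3] -/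
theorem codeFP_preList :
    CodeFP (pairE unE ctxE) (rawE natE)
      (fun p : ℕ × (ℕ × ℕ × ℕ × ℕ) =>
        (List.range (min (p.2.2.1 - p.2.1) p.1)).map (fun a => p.2.1 + a) ++
          (List.range (min p.2.2.2.2 p.1)).map (fun j => (p.2.2.1 + p.2.2.2.1) + j)) := by
  have hb : CodeFP (pairE unE ctxE) unE (fun p : ℕ × (ℕ × ℕ × ℕ × ℕ) => p.1) := fst _ _
  have hn : CodeFP (pairE unE ctxE) natE (fun p : ℕ × (ℕ × ℕ × ℕ × ℕ) => p.2.1) := (snd _ _).fst'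
  have hL : CodeFP (pairE unE ctxE) natE (fun p : ℕ × (ℕ × ℕ × ℕ × ℕ) => p.2.2.1) := (snd _ _).snd'.fst'
  have hm : CodeFP (pairE unE ctxE) natE (fun p : ℕ × (ℕ × ℕ × ℕ × ℕ) => p.2.2.2.1) := (snd _ _).snd'.snd'.fst'
  have hκ : CodeFP (pairE unE ctxE) natE (fun p : ℕ × (ℕ × ℕ × ℕ × ℕ) => p.2.2.2.2) := (snd _ _).snd'.snd'.snd'
  have h1 : CodeFP (pairE unE ctxE) (rawE natE)
      (fun p : ℕ × (ℕ × ℕ × ℕ × ℕ) => (List.range (min (p.2.2.1 - p.2.1) p.1)).map (fun a => p.2.1 + a)) :=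
    (codeFP_shiftRange.comp (hb.pair (hn.pair (natSub.comp (hL.pair hn))))).congr fun p => rfl
  have h2 : CodeFP (pairE unE ctxE) (rawE natE)
      (fun p : ℕ × (ℕ × ℕ × ℕ × ℕ) => (List.range (min p.2.2.2.2 p.1)).map (fun j => (p.2.2.1 + p.2.2.2.1) + j)) :=
    (codeFP_shiftRange.comp (hb.pair ((natAdd.comp (hL.pair hm)).pair hκ))).congr fun p => rfl
  exact ((rawAppend natE).comp (h1.pair h2)).congr fun p => rfl

/-- The code of the context of the gate map: `(prefix list, (n, L, m, κ))`. [cite: AroraBarak2009, §1.3] -/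
abbrev gctxE : List ℕ × (ℕ × ℕ × ℕ × ℕ) → List Bool := pairE (rawE natE) ctxE

/-- **`retargetRaw` is computed on codes** (context: the prefix list — precomputed — and `(n, L, m, κ)`).
[cite: BennettBernsteinBrassardVazirani1997, Thm. 4.14] [cite: AroraBarak2009, §1.3] -/
theorem codeFP_retargetRaw :
    CodeFP (pairE gctxE RawGate.E) RawGate.E
      (fun p : (List ℕ × (ℕ × ℕ × ℕ × ℕ)) × RawGate =>
        if p.2.1 then (true, ((p.1.2.2.1 - p.1.2.1) + p.1.2.2.2.2) + p.2.2.1, p.1.1 ++ p.2.2.2.map (embW p.1.2.1 p.1.2.2.1))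
        else (false, p.2.2.1, p.2.2.2.map (embW p.1.2.1 p.1.2.2.1))) := by
  have hpl : CodeFP (pairE gctxE RawGate.E) (rawE natE) (fun p : (List ℕ × (ℕ × ℕ × ℕ × ℕ)) × RawGate => p.1.1) :=
    (fst _ _).fst'
  have hctx : CodeFP (pairE gctxE RawGate.E) ctxE (fun p : (List ℕ × (ℕ × ℕ × ℕ × ℕ)) × RawGate => p.1.2) :=
    (fst _ _).snd'
  have hn : CodeFP (pairE gctxE RawGate.E) natE (fun p : (List ℕ × (ℕ × ℕ × ℕ × ℕ)) × RawGate => p.1.2.1) := hctx.fst'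
  have hL : CodeFP (pairE gctxE RawGate.E) natE (fun p : (List ℕ × (ℕ × ℕ × ℕ × ℕ)) × RawGate => p.1.2.2.1) :=
    hctx.snd'.fst'
  have hκ : CodeFP (pairE gctxE RawGate.E) natE (fun p : (List ℕ × (ℕ × ℕ × ℕ × ℕ)) × RawGate => p.1.2.2.2.2) :=
    hctx.snd'.snd'.snd'
  have hγ : CodeFP (pairE gctxE RawGate.E) RawGate.E (fun p : (List ℕ × (ℕ × ℕ × ℕ × ℕ)) × RawGate => p.2) := snd _ _
  have htag : CodeFP (pairE gctxE RawGate.E) bitE (fun p : (List ℕ × (ℕ × ℕ × ℕ × ℕ)) × RawGate => p.2.1) :=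
    RawGate.codeFP_tag.comp hγ
  have hbody : CodeFP (pairE gctxE RawGate.E) (pairE natE (listE natE))
      (fun p : (List ℕ × (ℕ × ℕ × ℕ × ℕ)) × RawGate => p.2.2) := RawGate.codeFP_body.comp hγ
  have hnum : CodeFP (pairE gctxE RawGate.E) natE (fun p : (List ℕ × (ℕ × ℕ × ℕ × ℕ)) × RawGate => p.2.2.1) :=
    hbody.fst'
  have hws : CodeFP (pairE gctxE RawGate.E) (rawE natE)
      (fun p : (List ℕ × (ℕ × ℕ × ℕ × ℕ)) × RawGate => p.2.2.2) := (rawOfList natE).comp hbody.snd'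
  have hmoved : CodeFP (pairE gctxE RawGate.E) (rawE natE)
      (fun p : (List ℕ × (ℕ × ℕ × ℕ × ℕ)) × RawGate => p.2.2.2.map (embW p.1.2.1 p.1.2.2.1)) :=
    ((map codeFP_embW).comp (hctx.pair hws)).congr fun p => rfl
  have hnum' : CodeFP (pairE gctxE RawGate.E) natE
      (fun p : (List ℕ × (ℕ × ℕ × ℕ × ℕ)) × RawGate => ((p.1.2.2.1 - p.1.2.1) + p.1.2.2.2.2) + p.2.2.1) :=
    natAdd.comp ((natAdd.comp ((natSub.comp (hL.pair hn)).pair hκ)).pair hnum)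
  have hws' : CodeFP (pairE gctxE RawGate.E) (listE natE)
      (fun p : (List ℕ × (ℕ × ℕ × ℕ × ℕ)) × RawGate => p.1.1 ++ p.2.2.2.map (embW p.1.2.1 p.1.2.2.1)) :=
    (listOfRaw natE).comp ((rawAppend natE).comp (hpl.pair hmoved))
  have hthen : CodeFP (pairE gctxE RawGate.E) RawGate.E
      (fun p : (List ℕ × (ℕ × ℕ × ℕ × ℕ)) × RawGate =>
        ((true, ((p.1.2.2.1 - p.1.2.1) + p.1.2.2.2.2) + p.2.2.1, p.1.1 ++ p.2.2.2.map (embW p.1.2.1 p.1.2.2.1)) : RawGate)) :=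
    (RawGate.codeFP_mk.comp ((const _ true).pair (hnum'.pair hws'))).congr fun p => rfl
  have helse : CodeFP (pairE gctxE RawGate.E) RawGate.E
      (fun p : (List ℕ × (ℕ × ℕ × ℕ × ℕ)) × RawGate => ((false, p.2.2.1, p.2.2.2.map (embW p.1.2.1 p.1.2.2.1)) : RawGate)) :=
    (RawGate.codeFP_mk.comp ((const _ false).pair (hnum.pair ((listOfRaw natE).comp hmoved)))).congr fun p => rfl
  exact (htag.ite hthen helse).congr fun p => rfl

/-- **The raw Hadamard layer is computed on codes** from `(budget in unary, (n, L, m, κ))` (as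
`(range (min κ budget)).map (j ↦ (0, 0, [L + m + j]))`). [cite: AroraBarak2009, §1.3] -/
theorem codeFP_hadRaw :
    CodeFP (pairE unE ctxE) (rawE RawGate.E)
      (fun p : ℕ × (ℕ × ℕ × ℕ × ℕ) =>
        (List.range (min p.2.2.2.2 p.1)).map fun j => ((false, 0, [(p.2.2.1 + p.2.2.2.1) + j]) : RawGate)) := by
  have hb : CodeFP (pairE unE ctxE) unE (fun p : ℕ × (ℕ × ℕ × ℕ × ℕ) => p.1) := fst _ _
  have hL : CodeFP (pairE unE ctxE) natE (fun p : ℕ × (ℕ × ℕ × ℕ × ℕ) => p.2.2.1) := (snd _ _).snd'.fst'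
  have hm : CodeFP (pairE unE ctxE) natE (fun p : ℕ × (ℕ × ℕ × ℕ × ℕ) => p.2.2.2.1) := (snd _ _).snd'.snd'.fst'
  have hκ : CodeFP (pairE unE ctxE) natE (fun p : ℕ × (ℕ × ℕ × ℕ × ℕ) => p.2.2.2.2) := (snd _ _).snd'.snd'.snd'
  have hws : CodeFP (pairE unE ctxE) (rawE natE)
      (fun p : ℕ × (ℕ × ℕ × ℕ × ℕ) => (List.range (min p.2.2.2.2 p.1)).map fun j => (p.2.2.1 + p.2.2.2.1) + j) :=
    (codeFP_shiftRange.comp (hb.pair ((natAdd.comp (hL.pair hm)).pair hκ))).congr fun p => rfl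
  -- one Hadamard raw gate from a wire index
  have hg : CodeFP (pairE unE natE) RawGate.E (fun q : ℕ × ℕ => ((false, 0, [q.2]) : RawGate)) :=
    (RawGate.codeFP_mk.comp ((const _ false).pair ((const _ 0).pair
      ((listOfRaw natE).comp ((rawSingleton natE).comp (snd _ _)))))).congr fun q => rfl
  exact ((map hg).comp (hb.pair hws)).congr fun p => by simp [List.map_map]

/-- **The raw description of the keyed family is computed on codes from `1^L`** (for uniform `F` and size
functions computed on unary codes). [cite: AroraBarak2009, §6.2 Remark 6.7] [cite: BennettBernsteinBrassardVazirani1997, Thm. 4.14] -/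
theorem codeFP_rawDescK (hF : P.F.IsUniform) (hn : CodeFP unE unE P.nOf) (hκ : CodeFP unE unE P.κOf) :
    CodeFP unE RawDesc.E P.rawDescK := by
  -- the raw description of `F.circ (nOf L)` and its fields
  have hD : CodeFP unE RawDesc.E (fun L => P.F.rawDesc (P.nOf L)) := (codeFP_rawDesc hF).comp hn
  have hmU : CodeFP unE unE (fun L => P.mF L) := (hD.snd'.fst').congr fun L => rfl
  have hgs : CodeFP unE (rawE RawGate.E) (fun L => (P.F.rawDesc (P.nOf L)).2.2) := hD.snd'.snd'
  -- the context `(n, L, m, κ)` in binary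
  have hctx : CodeFP unE ctxE (fun L => (P.nOf L, L, P.mF L, P.κOf L)) :=
    (natOfUn.comp hn).pair (natOfUn.pair ((natOfUn.comp hmU).pair (natOfUn.comp hκ)))
  -- the unary budget `L + κ` (bounds `L − n` and `κ`)
  have hbud : CodeFP unE unE (fun L => L + P.κOf L) := unAdd.comp ((CodeFP.id unE).pair hκ)
  have hmin1 : ∀ L, min (L - P.nOf L) (L + P.κOf L) = L - P.nOf L := fun L => min_eq_left (by omega)
  have hmin2 : ∀ L, min (P.κOf L) (L + P.κOf L) = P.κOf L := fun L => min_eq_left (by omega)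
  have hpl : CodeFP unE (rawE natE) (fun L => preList (P.nOf L) L (P.mF L) (P.κOf L)) :=
    (codeFP_preList.comp (hbud.pair hctx)).congr fun L => by simp only [preList, hmin1, hmin2]
  have hhad : CodeFP unE (rawE RawGate.E) (fun L => hadRaw L (P.mF L) (P.κOf L)) :=
    (codeFP_hadRaw.comp (hbud.pair hctx)).congr fun L => by simp only [hadRaw, hmin2]
  have hmap : CodeFP unE (rawE RawGate.E)
      (fun L => ((P.F.rawDesc (P.nOf L)).2.2).map (retargetRaw (P.nOf L) L (P.mF L) (P.κOf L))) :=
    ((map codeFP_retargetRaw).comp ((hpl.pair hctx).pair hgs)).congr fun L => rfl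
  have hanc : CodeFP unE unE (fun L => P.mF L + P.κOf L) := unAdd.comp (hmU.pair hκ)
  exact (natOfUn.pair (hanc.pair ((rawAppend RawGate.E).comp (hhad.pair hmap)))).congr fun L => rfl

/-- **The keyed-oracle family is polynomial-time uniform** for a uniform oracle algorithm `F` and size functions
`nOf, κOf` computed in polynomial time on unary numerals. [cite: BennettBernsteinBrassardVazirani1997, Thm. 4.14]
[cite: AroraBarak2009, §6.2 Remark 6.7] -/
theorem family_isUniform (hF : P.F.IsUniform) (hn : CodeFP unE unE P.nOf) (hκ : CodeFP unE unE P.κOf) :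
    P.family.IsUniform := by
  rw [QCircuitFamily.isUniform_iff_descFn_mem_FP]
  obtain ⟨f, hf, hfe⟩ := P.codeFP_rawDescK hF hn hκ
  have h : P.family.descFn = f ∘ onesFn := funext fun z => by
    rw [Function.comp_apply, QCircuitFamily.descFn_eq_E_rawDesc, onesFn, rawDesc_family, ← hfe]
  rw [h]
  exact comp_mem_FP hf onesFn_mem_FP

end KeyedRun

end Literature.Computability.QuantumComplexity

end
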